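/-
Copyright (c) 2026 the pub-hodgecm-mathlib formalisation cell (harness21).  Prover seat hodgecm-mathlib-K2E1-p11 (g6), Track B ∕ K2-LIT, h413 = `stmt-HodgeConjecture-24833`,
R90-TF section S8 «ContSpec-n½», the `hsrc` supplier estate, census `R90/S8/CENSUS-UnfoldingLetterFree.K2E1-p11-g6.md` f7bfa6fc755d5846 item (a) (S8 dealer R90-CS-plan (g3),
S8-R240 (2) ∕ S8-R246; the file R90-CS-p03 (g3) booked as `K2E1ChiFinReadingEntriesU3` on the R90 bus 2026-09-05T02:58:07Z and did not write): THE FINITE BIG-CELL ELEMENT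
`(ι(w₀)·u(X, s))_f · b₁` AS A MATRIX, GLOBALLY OVER `𝔸_{L,f}` AND PLACE BY PLACE — the input of ★ p864965 `hΩ_of_localReadings`' per-place readings.
-/
import Literature.NumberTheory.Automorphic.UnitaryGroupHeisenbergConjThreeFactor   -- ★ `coe_adelicVal_eq_heisMatrix` (`π(u) = u(x, z)` as a matrix), brings ★ `heisChart`, `coordX_heisChart`, `coordY_heisChart`, `heisMatrix`, `heisZ`
import Literature.NumberTheory.Automorphic.UnitaryGroupAdelicProduct                 -- ★ `finPart`, `coe_finPart`; brings ★ `evalPlace`, `coe_evalPlace_apply`, `GLn.evalAt`, `GLn.coe_evalAt_apply`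
import Literature.NumberTheory.Automorphic.UnitaryGroupRankOneBigCell                -- ★ `weylLongU`, `coe_coe_weylLongU_three`
import HarnessLib

/-!
# K2·E1 ∕ R90·S8 — `K2E1ChiFinReadingEntriesU3`: THE FINITE BIG-CELL ELEMENT `(ι(w₀)·u(X, s))_f · b₁` AS A MATRIX — over `𝔸_{L,f}`, at every finite place `w` of `L`, and in the
# `evalPlace` currency of the unitary factors `U(2,1)(L⁺_v) ≤ Π_{w∣v} GL₃(L_w)`; at a place where `(b₁)_w = Φ₃` it is the LOWER UNITRIANGULAR `n⁻(−σX_w, Z_w, X_w)`, where `(b₁)_w = 1` it is `w₀·u(X_w, Z_w)`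

Cell `pub/hodgecm-mathlib`, crux h413 = `stmt-HodgeConjecture-24833`, route of record `HCCMUnconditional`; R90-TF section S8 «ContSpec-n½», road R2-χ₃ ((V)∕(R)′ OF RECORD row `hsrc`: the
pure-tensor letter `hΩ` of ★ p864821 `hsrc_of_record_at_basePoint_of_core` reads the finite witness at the points `(ι(w₀)·u((0,X_f),θ(0,s_f)))_f·b₁`; ★ p864965 `hΩ_of_localReadings` reduces
`hΩ` to PER-PLACE readings of `evalPlace v` of these points — this file computes them).  THEOREMS ONLY (no `def`, no `instance`, no `notation`, no named-fact hypothesis, no `sorry`; default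
heartbeats); lane `--supports stmt-HodgeConjecture-24833 --as helper` (count-neutral).  Closes no socket.  Pure matrix plumbing.

THE MATHEMATICS ([Rogawski1990] §1.10 p. 9, §4.5; [BorelJacquet1979] §4.1; [CasselsFrohlichANT1967] Ch. II §14).  In `U(2,1)(𝔸_{L⁺}) ≤ GL₃(𝔸_L)` the long Weyl element is `ι(w₀) = Φ₃ =
antidiag(1,1,1)` and the Heisenberg element of the chart is `u(X, s) = (1 X Z; 0 1 −σX; 0 0 1)`, `Z = z(X, s) = s − ½XσX` (★ `heisMatrix`, ★ `coe_adelicVal_eq_heisMatrix`).  Hence the finite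
component of `ι(w₀)·u(X, s)` is the `GL₃(𝔸_{L,f})` matrix **`(0 0 1; 0 1 −σX_f; 1 X_f Z_f)`** (§1: `(·)_f = GLn.sndHom` entrywise, rows of `u` reversed), so for any `b₁ ∈ U(2,1)(𝔸_{L⁺,f})` the
point `(ι(w₀)·u(X,s))_f · b₁` has matrix `(0 0 1; 0 1 −σX_f; 1 X_f Z_f)·b₁` and, at every finite place `w` of `L`, `w`-component **`(0 0 1; 0 1 −σX_w; 1 X_w Z_w)·(b₁)_w`** (§2: `GLn.evalAt`
is entrywise evaluation, a ring map).  Two special base-point components: where `(b₁)_w = Φ₃` (the places of `S₀` for the MOVED base point `ι_f(w₀^{S₀})`) the component is the LOWER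
UNITRIANGULAR **`n⁻ = (1 0 0; −σX_w 1 0; Z_w X_w 1)`** (§3; ★ (E-cell) `antidiag_mul_heis_mul_antidiag`'s shape — the input of ★ p864965 `localReading_on∕off_of_lowerUnitriangular`); where
`(b₁)_w = 1` (the places off `S₀`) it is **`w₀·u(X_w, Z_w) = (0 0 1; 0 1 −σX_w; 1 X_w Z_w)`** itself (§3; the input of the good-place Iwasawa bricks ★ `K2E1BigCellIwasawaTorusEntryU3{,Letters,Witness}`,
★ `K2E1BigCellIwasawaTorusEntrySplitU3`).  §4 re-indexes along `w ↦ (v := w ∩ L⁺, w)` into the `evalPlace v` ∕ `PlacesOver L v` currency of ★ p864759 ∕ ★ p864965 (`coe_evalPlace_apply`, rfl).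
* §1 `adelicVal_toAdelic_weylLongU_apply`, **`coe_finPart_weylLongU_mul_heisChart`**, **`coe_finPart_weylLongU_mul_heisChart_mul`**.
* §2 **`coe_evalAt_finPart_weylLongU_mul_heisChart_mul`** (any `b₁`, any `w`).
* §3 **`coe_evalAt_finPart_weylLongU_mul_heisChart_mul_of_evalAt_eq_antidiag`** (`(b₁)_w = Φ₃` ⇒ `n⁻`), **`coe_evalAt_finPart_weylLongU_mul_heisChart_mul_of_evalAt_eq_one`** (`(b₁)_w = 1` ⇒ `w₀·u`).
* §4 **`coe_evalPlace_finPart_weylLongU_mul_heisChart_mul`**, **`…_of_evalPlace_eq_antidiag`**, **`…_of_evalPlace_eq_one`** (the `PlacesOver` forms).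
HONEST LABEL: HC_CM is proved only modulo the 7 printed citations (2 remaining named inputs: hLiu418 = `stmt-HodgeConjecture-24832`, h413 = `stmt-HodgeConjecture-24833`) until rung 0
closes; REL ≠ ★ ≠ BUILT; unconditional matrix algebra; asserts no named fact, closes no socket; count-neutral.

## References
* [Rogawski1990] J. D. Rogawski, *Automorphic Representations of Unitary Groups in Three Variables*, Ann. of Math. Stud. 123 (1990), §1.10 p. 9, §4.5 p. 45.
* [BorelJacquet1979] A. Borel, H. Jacquet, *Automorphic forms and automorphic representations*, Proc. Symp. Pure Math. 33.1 (1979), §4.1.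
* [CasselsFrohlichANT1967] J. W. S. Cassels, A. Fröhlich (eds.), *Algebraic Number Theory* (1967), Ch. II §14.
-/

set_option autoImplicit false
set_option linter.dupNamespace false  -- the mandated namespace repeats the summit's segment (`HodgeConjecture.HodgeConjecture`)

noncomputable section

open NumberField IsDedekindDomain
open Literature.NumberTheory.Automorphic Literature.NumberTheory.Automorphic.UnitaryGroup AdelicGroupData

namespace Summit.HodgeConjecture.HodgeConjecture.Cruxes.H413.K2E1ChiFinReadingEntriesU3

variable (L : Type) [Field L] [NumberField L] [IsCMField L] (hc : IsCMField.complexConj L * IsCMField.complexConj L = 1)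

/-! ## §1 The finite component of `ι(w₀)·u(X, s)` (and of its right translates by `b₁`) as a matrix over `𝔸_{L,f}` -/

/-- The adelic matrix of `ι(w₀)` is `Φ₃ = antidiag(1,1,1)` (★ `coe_coe_weylLongU_three`, entrywise `algebraMap L 𝔸_L`). [cite: Rogawski1990, §1.10 p. 9] -/
theorem adelicVal_toAdelic_weylLongU_apply (i j : Fin 3) :
    ((adelicVal (↥(maximalRealSubfield L)) L (IsCMField.complexConj L) 3 ((StdForm.antidiagonal 3).over L)
        ((quasiSplit (↥(maximalRealSubfield L)) L (IsCMField.complexConj L) 3).toAdelic (weylLongU ((IsCMField.complexConj L : L ≃ₐ[↥(maximalRealSubfield L)] L) : L →+* L) (rfl : (StdForm.antidiagonal 3).over L = (StdForm.antidiagonal 3).over L))) :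
        GL (Fin 3) (AdeleRing (𝓞 L) L)) : Matrix (Fin 3) (Fin 3) (AdeleRing (𝓞 L) L)) i j = (!![(0 : AdeleRing (𝓞 L) L), 0, 1; 0, 1, 0; 1, 0, 0]) i j := by
  change algebraMap L (AdeleRing (𝓞 L) L) ((((weylLongU ((IsCMField.complexConj L : L ≃ₐ[↥(maximalRealSubfield L)] L) : L →+* L) (rfl : (StdForm.antidiagonal 3).over L = (StdForm.antidiagonal 3).over L) :
      ↥(unitaryGroupOfForm ((IsCMField.complexConj L : L ≃ₐ[↥(maximalRealSubfield L)] L) : L →+* L) ((StdForm.antidiagonal 3).over L))) : GL (Fin 3) L) : Matrix (Fin 3) (Fin 3) L) i j) = _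
  rw [coe_coe_weylLongU_three]
  fin_cases i <;> fin_cases j <;> simp

/-- **`(ι(w₀)·u(X, s))_f = (0 0 1; 0 1 −σX_f; 1 X_f Z_f)`** in `GL₃(𝔸_{L,f})`, `Z = z(X, s) = s − ½XσX` (★ `heisZ`): `(·)_f` is entrywise the finite component, `ι(w₀) = Φ₃` reverses the rows of
`u(X, s) = (1 X Z; 0 1 −σX; 0 0 1)` (★ `coe_adelicVal_eq_heisMatrix`). [cite: Rogawski1990, §1.10 p. 9] [cite: BorelJacquet1979, §4.1] -/
theorem coe_finPart_weylLongU_mul_heisChart (X : AdeleRing (𝓞 L) L) (s : traceZeroAdele (↥(maximalRealSubfield L)) L (IsCMField.complexConj L)) :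
    (((finPart (↥(maximalRealSubfield L)) L (IsCMField.complexConj L) 3 ((StdForm.antidiagonal 3).over L)
        ((quasiSplit (↥(maximalRealSubfield L)) L (IsCMField.complexConj L) 3).toAdelic (weylLongU ((IsCMField.complexConj L : L ≃ₐ[↥(maximalRealSubfield L)] L) : L →+* L) (rfl : (StdForm.antidiagonal 3).over L = (StdForm.antidiagonal 3).over L)) *
          ((heisChart hc (X, s) : ↥(adelicUnipotent ↥(maximalRealSubfield L) L (IsCMField.complexConj L) 3)) : (quasiSplit (↥(maximalRealSubfield L)) L (IsCMField.complexConj L) 3).Adelic)) :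
        ↥(finAdelic (↥(maximalRealSubfield L)) L (IsCMField.complexConj L) 3 ((StdForm.antidiagonal 3).over L))) : GL (Fin 3) (FiniteAdeleRing (𝓞 L) L)) : Matrix (Fin 3) (Fin 3) (FiniteAdeleRing (𝓞 L) L)) =
      !![0, 0, 1; 0, 1, -(conjAdele (↥(maximalRealSubfield L)) L (IsCMField.complexConj L) X).2; 1, X.2, (heisZ (c := IsCMField.complexConj L) X (s : AdeleRing (𝓞 L) L)).2] := by
  -- `(·)_f` of the entries, read on the `def` `AdeleRing = InfiniteAdeleRing × FiniteAdeleRing` through `rfl`-lemmas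
  have hsnd : ∀ (g : GL (Fin 3) (AdeleRing (𝓞 L) L)) (i j : Fin 3), ((GLn.sndHom 3 L g : GL (Fin 3) (FiniteAdeleRing (𝓞 L) L)) : Matrix (Fin 3) (Fin 3) (FiniteAdeleRing (𝓞 L) L)) i j =
      ((g : Matrix (Fin 3) (Fin 3) (AdeleRing (𝓞 L) L)) i j).2 := fun _ _ _ => rfl
  have hneg : ∀ a : AdeleRing (𝓞 L) L, (-a).2 = -a.2 := fun _ => rfl
  have h1 : (1 : AdeleRing (𝓞 L) L).2 = 1 := rfl
  have h0 : (0 : AdeleRing (𝓞 L) L).2 = 0 := rfl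
  have hW := adelicVal_toAdelic_weylLongU_apply L
  ext i j
  rw [coe_finPart, hsnd, map_mul, Units.val_mul, Matrix.mul_apply, Fin.sum_univ_three, hW, hW, hW, coe_adelicVal_eq_heisMatrix hc, coordX_heisChart, coordY_heisChart]
  fin_cases i <;> fin_cases j <;> simp [heisMatrix, hneg, h1, h0]

/-- **`(ι(w₀)·u(X, s))_f · b₁ = (0 0 1; 0 1 −σX_f; 1 X_f Z_f)·b₁`** in `GL₃(𝔸_{L,f})`, for any `b₁ ∈ U(2,1)(𝔸_{L⁺,f})`. [cite: Rogawski1990, §1.10 p. 9] [cite: BorelJacquet1979, §4.1] -/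
theorem coe_finPart_weylLongU_mul_heisChart_mul (X : AdeleRing (𝓞 L) L) (s : traceZeroAdele (↥(maximalRealSubfield L)) L (IsCMField.complexConj L))
    (b₁ : ↥(finAdelic (↥(maximalRealSubfield L)) L (IsCMField.complexConj L) 3 ((StdForm.antidiagonal 3).over L))) :
    (((finPart (↥(maximalRealSubfield L)) L (IsCMField.complexConj L) 3 ((StdForm.antidiagonal 3).over L)
        ((quasiSplit (↥(maximalRealSubfield L)) L (IsCMField.complexConj L) 3).toAdelic (weylLongU ((IsCMField.complexConj L : L ≃ₐ[↥(maximalRealSubfield L)] L) : L →+* L) (rfl : (StdForm.antidiagonal 3).over L = (StdForm.antidiagonal 3).over L)) *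
          ((heisChart hc (X, s) : ↥(adelicUnipotent ↥(maximalRealSubfield L) L (IsCMField.complexConj L) 3)) : (quasiSplit (↥(maximalRealSubfield L)) L (IsCMField.complexConj L) 3).Adelic)) * b₁ :
        ↥(finAdelic (↥(maximalRealSubfield L)) L (IsCMField.complexConj L) 3 ((StdForm.antidiagonal 3).over L))) : GL (Fin 3) (FiniteAdeleRing (𝓞 L) L)) : Matrix (Fin 3) (Fin 3) (FiniteAdeleRing (𝓞 L) L)) =
      !![0, 0, 1; 0, 1, -(conjAdele (↥(maximalRealSubfield L)) L (IsCMField.complexConj L) X).2; 1, X.2, (heisZ (c := IsCMField.complexConj L) X (s : AdeleRing (𝓞 L) L)).2] *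
        ((b₁ : GL (Fin 3) (FiniteAdeleRing (𝓞 L) L)) : Matrix (Fin 3) (Fin 3) (FiniteAdeleRing (𝓞 L) L)) := by
  rw [Subgroup.coe_mul, Units.val_mul, coe_finPart_weylLongU_mul_heisChart L hc X s]

/-! ## §2 The component at a finite place `w` of `L` -/

omit [IsCMField L] in
/-- `GLn.evalAt w` is entrywise evaluation, hence multiplicative on matrices: `((g·h)_w) = g_w·h_w` as matrices (it is a monoid hom). [folklore] -/
theorem coe_evalAt_mul (w : HeightOneSpectrum (𝓞 L)) (g h : GL (Fin 3) (FiniteAdeleRing (𝓞 L) L)) :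
    ((GLn.evalAt 3 L w (g * h) : GL (Fin 3) (w.adicCompletion L)) : Matrix (Fin 3) (Fin 3) (w.adicCompletion L)) =
      ((GLn.evalAt 3 L w g : GL (Fin 3) (w.adicCompletion L)) : Matrix (Fin 3) (Fin 3) (w.adicCompletion L)) * ((GLn.evalAt 3 L w h : GL (Fin 3) (w.adicCompletion L)) : Matrix (Fin 3) (Fin 3) (w.adicCompletion L)) := by
  rw [map_mul, Units.val_mul]

/-- **THE `w`-COMPONENT: `((ι(w₀)·u(X, s))_f · b₁)_w = (0 0 1; 0 1 −σX_w; 1 X_w Z_w)·(b₁)_w`** in `GL₃(L_w)`, at every finite place `w` of `L` (`GLn.evalAt` is entrywise evaluation at `w`, a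
ring map; `X_w = X_f(w)`, `σX_w = (σX)_f(w)`, `Z_w = Z_f(w)`). [cite: Rogawski1990, §1.10 p. 9] [cite: CasselsFrohlichANT1967, Ch. II §14] -/
theorem coe_evalAt_finPart_weylLongU_mul_heisChart_mul (X : AdeleRing (𝓞 L) L) (s : traceZeroAdele (↥(maximalRealSubfield L)) L (IsCMField.complexConj L))
    (b₁ : ↥(finAdelic (↥(maximalRealSubfield L)) L (IsCMField.complexConj L) 3 ((StdForm.antidiagonal 3).over L))) (w : HeightOneSpectrum (𝓞 L)) :
    ((GLn.evalAt 3 L w ((finPart (↥(maximalRealSubfield L)) L (IsCMField.complexConj L) 3 ((StdForm.antidiagonal 3).over L)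
        ((quasiSplit (↥(maximalRealSubfield L)) L (IsCMField.complexConj L) 3).toAdelic (weylLongU ((IsCMField.complexConj L : L ≃ₐ[↥(maximalRealSubfield L)] L) : L →+* L) (rfl : (StdForm.antidiagonal 3).over L = (StdForm.antidiagonal 3).over L)) *
          ((heisChart hc (X, s) : ↥(adelicUnipotent ↥(maximalRealSubfield L) L (IsCMField.complexConj L) 3)) : (quasiSplit (↥(maximalRealSubfield L)) L (IsCMField.complexConj L) 3).Adelic)) * b₁ :
        ↥(finAdelic (↥(maximalRealSubfield L)) L (IsCMField.complexConj L) 3 ((StdForm.antidiagonal 3).over L))) : GL (Fin 3) (FiniteAdeleRing (𝓞 L) L)) : GL (Fin 3) (w.adicCompletion L)) :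
        Matrix (Fin 3) (Fin 3) (w.adicCompletion L)) =
      !![0, 0, 1; 0, 1, -((conjAdele (↥(maximalRealSubfield L)) L (IsCMField.complexConj L) X).2 w); 1, X.2 w, (heisZ (c := IsCMField.complexConj L) X (s : AdeleRing (𝓞 L) L)).2 w] *
        ((GLn.evalAt 3 L w (b₁ : GL (Fin 3) (FiniteAdeleRing (𝓞 L) L)) : GL (Fin 3) (w.adicCompletion L)) : Matrix (Fin 3) (Fin 3) (w.adicCompletion L)) := by
  -- `GLn.evalAt w` is `Matrix.map` of the evaluation ring map (definitional)
  have hmap : ∀ g : GL (Fin 3) (FiniteAdeleRing (𝓞 L) L), ((GLn.evalAt 3 L w g : GL (Fin 3) (w.adicCompletion L)) : Matrix (Fin 3) (Fin 3) (w.adicCompletion L)) =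
      (g : Matrix (Fin 3) (Fin 3) (FiniteAdeleRing (𝓞 L) L)).map (finiteAdeleEval L w) := fun _ => rfl
  rw [Subgroup.coe_mul, coe_evalAt_mul]
  congr 1
  rw [hmap, coe_finPart_weylLongU_mul_heisChart L hc X s]
  ext i j
  fin_cases i <;> fin_cases j <;> simp [Matrix.map_apply, -finiteAdeleEval_apply] <;> rfl

/-! ## §3 The two base-point components: `(b₁)_w = Φ₃` (lower unitriangular `n⁻`) and `(b₁)_w = 1` (`w₀·u`) -/

/-- **AT A PLACE WHERE `(b₁)_w = Φ₃`: `((ι(w₀)·u(X, s))_f · b₁)_w = n⁻ = (1 0 0; −σX_w 1 0; Z_w X_w 1)`**, LOWER UNITRIANGULAR — the shape of ★ (E-cell) `antidiag_mul_heis_mul_antidiag` and the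
input of ★ p864965 `localReading_on_of_lowerUnitriangular` ∕ `localReading_off_of_lowerUnitriangular` (with `a_w = −σX_w`, `b_w = Z_w`, `d_w = X_w`): the places `v ∈ S₀` of the MOVED base point
`ι_f(w₀^{S₀})`. [cite: Rogawski1990, §1.10 p. 9, §4.5 p. 45] -/
theorem coe_evalAt_finPart_weylLongU_mul_heisChart_mul_of_evalAt_eq_antidiag (X : AdeleRing (𝓞 L) L) (s : traceZeroAdele (↥(maximalRealSubfield L)) L (IsCMField.complexConj L))
    (b₁ : ↥(finAdelic (↥(maximalRealSubfield L)) L (IsCMField.complexConj L) 3 ((StdForm.antidiagonal 3).over L))) (w : HeightOneSpectrum (𝓞 L))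
    (hb₁ : ((GLn.evalAt 3 L w (b₁ : GL (Fin 3) (FiniteAdeleRing (𝓞 L) L)) : GL (Fin 3) (w.adicCompletion L)) : Matrix (Fin 3) (Fin 3) (w.adicCompletion L)) = !![0, 0, 1; 0, 1, 0; 1, 0, 0]) :
    ((GLn.evalAt 3 L w ((finPart (↥(maximalRealSubfield L)) L (IsCMField.complexConj L) 3 ((StdForm.antidiagonal 3).over L)
        ((quasiSplit (↥(maximalRealSubfield L)) L (IsCMField.complexConj L) 3).toAdelic (weylLongU ((IsCMField.complexConj L : L ≃ₐ[↥(maximalRealSubfield L)] L) : L →+* L) (rfl : (StdForm.antidiagonal 3).over L = (StdForm.antidiagonal 3).over L)) *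
          ((heisChart hc (X, s) : ↥(adelicUnipotent ↥(maximalRealSubfield L) L (IsCMField.complexConj L) 3)) : (quasiSplit (↥(maximalRealSubfield L)) L (IsCMField.complexConj L) 3).Adelic)) * b₁ :
        ↥(finAdelic (↥(maximalRealSubfield L)) L (IsCMField.complexConj L) 3 ((StdForm.antidiagonal 3).over L))) : GL (Fin 3) (FiniteAdeleRing (𝓞 L) L)) : GL (Fin 3) (w.adicCompletion L)) :
        Matrix (Fin 3) (Fin 3) (w.adicCompletion L)) =
      !![1, 0, 0; -((conjAdele (↥(maximalRealSubfield L)) L (IsCMField.complexConj L) X).2 w), 1, 0; (heisZ (c := IsCMField.complexConj L) X (s : AdeleRing (𝓞 L) L)).2 w, X.2 w, 1] := by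
  rw [coe_evalAt_finPart_weylLongU_mul_heisChart_mul L hc X s b₁ w, hb₁]
  ext i j
  fin_cases i <;> fin_cases j <;> simp [Matrix.mul_apply, Fin.sum_univ_three]

/-- **AT A PLACE WHERE `(b₁)_w = 1`: `((ι(w₀)·u(X, s))_f · b₁)_w = w₀·u(X_w, Z_w) = (0 0 1; 0 1 −σX_w; 1 X_w Z_w)`** — the input shape of the good-place Iwasawa bricks (★
`K2E1BigCellIwasawaTorusEntryU3.exists_borel_mul_integral_eq_weylLong_mul_of_nonsplit`, ★ `K2E1BigCellIwasawaTorusEntrySplitU3.exists_iwasawa_torusEntries_split`): the places off `S₀`.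
[cite: Rogawski1990, §1.10 p. 9, §4.5 p. 45] -/
theorem coe_evalAt_finPart_weylLongU_mul_heisChart_mul_of_evalAt_eq_one (X : AdeleRing (𝓞 L) L) (s : traceZeroAdele (↥(maximalRealSubfield L)) L (IsCMField.complexConj L))
    (b₁ : ↥(finAdelic (↥(maximalRealSubfield L)) L (IsCMField.complexConj L) 3 ((StdForm.antidiagonal 3).over L))) (w : HeightOneSpectrum (𝓞 L))
    (hb₁ : ((GLn.evalAt 3 L w (b₁ : GL (Fin 3) (FiniteAdeleRing (𝓞 L) L)) : GL (Fin 3) (w.adicCompletion L)) : Matrix (Fin 3) (Fin 3) (w.adicCompletion L)) = 1) :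
    ((GLn.evalAt 3 L w ((finPart (↥(maximalRealSubfield L)) L (IsCMField.complexConj L) 3 ((StdForm.antidiagonal 3).over L)
        ((quasiSplit (↥(maximalRealSubfield L)) L (IsCMField.complexConj L) 3).toAdelic (weylLongU ((IsCMField.complexConj L : L ≃ₐ[↥(maximalRealSubfield L)] L) : L →+* L) (rfl : (StdForm.antidiagonal 3).over L = (StdForm.antidiagonal 3).over L)) *
          ((heisChart hc (X, s) : ↥(adelicUnipotent ↥(maximalRealSubfield L) L (IsCMField.complexConj L) 3)) : (quasiSplit (↥(maximalRealSubfield L)) L (IsCMField.complexConj L) 3).Adelic)) * b₁ :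
        ↥(finAdelic (↥(maximalRealSubfield L)) L (IsCMField.complexConj L) 3 ((StdForm.antidiagonal 3).over L))) : GL (Fin 3) (FiniteAdeleRing (𝓞 L) L)) : GL (Fin 3) (w.adicCompletion L)) :
        Matrix (Fin 3) (Fin 3) (w.adicCompletion L)) =
      !![0, 0, 1; 0, 1, -((conjAdele (↥(maximalRealSubfield L)) L (IsCMField.complexConj L) X).2 w); 1, X.2 w, (heisZ (c := IsCMField.complexConj L) X (s : AdeleRing (𝓞 L) L)).2 w] := by
  rw [coe_evalAt_finPart_weylLongU_mul_heisChart_mul L hc X s b₁ w, hb₁, mul_one]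

/-! ## §4 The same in the `evalPlace v` ∕ `PlacesOver L v` currency of the unitary factors (★ p864759, ★ p864965) -/

/-- **THE `(v, w)`-COMPONENT IN THE UNITARY FACTOR**: for a finite place `v` of `L⁺` and `w ∣ v`, the `w`-coordinate of `evalPlace v (((ι(w₀)·u(X, s))_f · b₁))` is
`(0 0 1; 0 1 −σX_w; 1 X_w Z_w)·((b₁)_v)_w` (§2 re-indexed through ★ `coe_evalPlace_apply`, rfl). [cite: Rogawski1990, §1.10 p. 9] [cite: BorelJacquet1979, §4.1] -/
theorem coe_evalPlace_finPart_weylLongU_mul_heisChart_mul (X : AdeleRing (𝓞 L) L) (s : traceZeroAdele (↥(maximalRealSubfield L)) L (IsCMField.complexConj L))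
    (b₁ : ↥(finAdelic (↥(maximalRealSubfield L)) L (IsCMField.complexConj L) 3 ((StdForm.antidiagonal 3).over L))) (v : HeightOneSpectrum (𝓞 ↥(maximalRealSubfield L))) (w : PlacesOver L v) :
    ((((evalPlace (↥(maximalRealSubfield L)) L (IsCMField.complexConj L) 3 ((StdForm.antidiagonal 3).over L) v
        (finPart (↥(maximalRealSubfield L)) L (IsCMField.complexConj L) 3 ((StdForm.antidiagonal 3).over L)
          ((quasiSplit (↥(maximalRealSubfield L)) L (IsCMField.complexConj L) 3).toAdelic (weylLongU ((IsCMField.complexConj L : L ≃ₐ[↥(maximalRealSubfield L)] L) : L →+* L) (rfl : (StdForm.antidiagonal 3).over L = (StdForm.antidiagonal 3).over L)) *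
            ((heisChart hc (X, s) : ↥(adelicUnipotent ↥(maximalRealSubfield L) L (IsCMField.complexConj L) 3)) : (quasiSplit (↥(maximalRealSubfield L)) L (IsCMField.complexConj L) 3).Adelic)) * b₁) :
        localPi L (IsCMField.complexConj L) 3 ((StdForm.antidiagonal 3).over L) v) : LocalGLPi L 3 v) w : GL (Fin 3) (w.1.adicCompletion L)) : Matrix (Fin 3) (Fin 3) (w.1.adicCompletion L)) =
      !![0, 0, 1; 0, 1, -((conjAdele (↥(maximalRealSubfield L)) L (IsCMField.complexConj L) X).2 w.1); 1, X.2 w.1, (heisZ (c := IsCMField.complexConj L) X (s : AdeleRing (𝓞 L) L)).2 w.1] *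
        ((((evalPlace (↥(maximalRealSubfield L)) L (IsCMField.complexConj L) 3 ((StdForm.antidiagonal 3).over L) v b₁ : localPi L (IsCMField.complexConj L) 3 ((StdForm.antidiagonal 3).over L) v) : LocalGLPi L 3 v) w :
          GL (Fin 3) (w.1.adicCompletion L)) : Matrix (Fin 3) (Fin 3) (w.1.adicCompletion L)) := by
  rw [coe_evalPlace_apply, coe_evalPlace_apply]
  exact coe_evalAt_finPart_weylLongU_mul_heisChart_mul L hc X s b₁ w.1

/-- **`((b₁)_v)_w = Φ₃` ⇒ the `(v, w)`-component is `n⁻ = (1 0 0; −σX_w 1 0; Z_w X_w 1)`** (★ p864965 `localReading_*_of_lowerUnitriangular`'s hypothesis `hg` at `a_w = −σX_w`, `b_w = Z_w`,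
`d_w = X_w`). [cite: Rogawski1990, §1.10 p. 9, §4.5 p. 45] -/
theorem coe_evalPlace_finPart_weylLongU_mul_heisChart_mul_of_evalPlace_eq_antidiag (X : AdeleRing (𝓞 L) L) (s : traceZeroAdele (↥(maximalRealSubfield L)) L (IsCMField.complexConj L))
    (b₁ : ↥(finAdelic (↥(maximalRealSubfield L)) L (IsCMField.complexConj L) 3 ((StdForm.antidiagonal 3).over L))) (v : HeightOneSpectrum (𝓞 ↥(maximalRealSubfield L))) (w : PlacesOver L v)
    (hb₁ : ((((evalPlace (↥(maximalRealSubfield L)) L (IsCMField.complexConj L) 3 ((StdForm.antidiagonal 3).over L) v b₁ : localPi L (IsCMField.complexConj L) 3 ((StdForm.antidiagonal 3).over L) v) : LocalGLPi L 3 v) w :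
      GL (Fin 3) (w.1.adicCompletion L)) : Matrix (Fin 3) (Fin 3) (w.1.adicCompletion L)) = !![0, 0, 1; 0, 1, 0; 1, 0, 0]) :
    ((((evalPlace (↥(maximalRealSubfield L)) L (IsCMField.complexConj L) 3 ((StdForm.antidiagonal 3).over L) v
        (finPart (↥(maximalRealSubfield L)) L (IsCMField.complexConj L) 3 ((StdForm.antidiagonal 3).over L)
          ((quasiSplit (↥(maximalRealSubfield L)) L (IsCMField.complexConj L) 3).toAdelic (weylLongU ((IsCMField.complexConj L : L ≃ₐ[↥(maximalRealSubfield L)] L) : L →+* L) (rfl : (StdForm.antidiagonal 3).over L = (StdForm.antidiagonal 3).over L)) *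
            ((heisChart hc (X, s) : ↥(adelicUnipotent ↥(maximalRealSubfield L) L (IsCMField.complexConj L) 3)) : (quasiSplit (↥(maximalRealSubfield L)) L (IsCMField.complexConj L) 3).Adelic)) * b₁) :
        localPi L (IsCMField.complexConj L) 3 ((StdForm.antidiagonal 3).over L) v) : LocalGLPi L 3 v) w : GL (Fin 3) (w.1.adicCompletion L)) : Matrix (Fin 3) (Fin 3) (w.1.adicCompletion L)) =
      !![1, 0, 0; -((conjAdele (↥(maximalRealSubfield L)) L (IsCMField.complexConj L) X).2 w.1), 1, 0; (heisZ (c := IsCMField.complexConj L) X (s : AdeleRing (𝓞 L) L)).2 w.1, X.2 w.1, 1] := by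
  rw [coe_evalPlace_apply] at hb₁ ⊢
  exact coe_evalAt_finPart_weylLongU_mul_heisChart_mul_of_evalAt_eq_antidiag L hc X s b₁ w.1 hb₁

/-- **`((b₁)_v)_w = 1` ⇒ the `(v, w)`-component is `w₀·u(X_w, Z_w) = (0 0 1; 0 1 −σX_w; 1 X_w Z_w)`** (the good-place Iwasawa bricks' input). [cite: Rogawski1990, §1.10 p. 9, §4.5 p. 45] -/
theorem coe_evalPlace_finPart_weylLongU_mul_heisChart_mul_of_evalPlace_eq_one (X : AdeleRing (𝓞 L) L) (s : traceZeroAdele (↥(maximalRealSubfield L)) L (IsCMField.complexConj L))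
    (b₁ : ↥(finAdelic (↥(maximalRealSubfield L)) L (IsCMField.complexConj L) 3 ((StdForm.antidiagonal 3).over L))) (v : HeightOneSpectrum (𝓞 ↥(maximalRealSubfield L))) (w : PlacesOver L v)
    (hb₁ : ((((evalPlace (↥(maximalRealSubfield L)) L (IsCMField.complexConj L) 3 ((StdForm.antidiagonal 3).over L) v b₁ : localPi L (IsCMField.complexConj L) 3 ((StdForm.antidiagonal 3).over L) v) : LocalGLPi L 3 v) w :
      GL (Fin 3) (w.1.adicCompletion L)) : Matrix (Fin 3) (Fin 3) (w.1.adicCompletion L)) = 1) :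
    ((((evalPlace (↥(maximalRealSubfield L)) L (IsCMField.complexConj L) 3 ((StdForm.antidiagonal 3).over L) v
        (finPart (↥(maximalRealSubfield L)) L (IsCMField.complexConj L) 3 ((StdForm.antidiagonal 3).over L)
          ((quasiSplit (↥(maximalRealSubfield L)) L (IsCMField.complexConj L) 3).toAdelic (weylLongU ((IsCMField.complexConj L : L ≃ₐ[↥(maximalRealSubfield L)] L) : L →+* L) (rfl : (StdForm.antidiagonal 3).over L = (StdForm.antidiagonal 3).over L)) *
            ((heisChart hc (X, s) : ↥(adelicUnipotent ↥(maximalRealSubfield L) L (IsCMField.complexConj L) 3)) : (quasiSplit (↥(maximalRealSubfield L)) L (IsCMField.complexConj L) 3).Adelic)) * b₁) :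
        localPi L (IsCMField.complexConj L) 3 ((StdForm.antidiagonal 3).over L) v) : LocalGLPi L 3 v) w : GL (Fin 3) (w.1.adicCompletion L)) : Matrix (Fin 3) (Fin 3) (w.1.adicCompletion L)) =
      !![0, 0, 1; 0, 1, -((conjAdele (↥(maximalRealSubfield L)) L (IsCMField.complexConj L) X).2 w.1); 1, X.2 w.1, (heisZ (c := IsCMField.complexConj L) X (s : AdeleRing (𝓞 L) L)).2 w.1] := by
  rw [coe_evalPlace_apply] at hb₁ ⊢
  exact coe_evalAt_finPart_weylLongU_mul_heisChart_mul_of_evalAt_eq_one L hc X s b₁ w.1 hb₁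

end Summit.HodgeConjecture.HodgeConjecture.Cruxes.H413.K2E1ChiFinReadingEntriesU3

end
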